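import Mathlib.Algebra.Field.ZMod
import Mathlib.Topology.Instances.ZMod
import Mathlib.LinearAlgebra.Finsupp.Supported
import Mathlib.LinearAlgebra.Finsupp.VectorSpace
import Mathlib.RingTheory.Finiteness.Cardinality
import Mathlib.RingTheory.Finiteness.Prod
import Literature.NumberTheory.Automorphic.JacquetModule
import HarnessLib

/-!
# The named fact `Representation.isAdmissible_jacquetModule` is false as stated

The fact `Representation.isAdmissible_jacquetModule` (file
`Literature.NumberTheory.Automorphic.JacquetModule`; Casselman 1995, Thm. 3.3.1) was written in a
section declaring `[Field k] [CharZero k] … [IsTopologicalGroup G]`, and its docstring says "for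
`k` a field of characteristic `0`"; but a `def` only absorbs the section variables its body uses,
so `[CharZero k]` and `[IsTopologicalGroup G]` were silently dropped and the constant is the
characteristic-free statement
`∀ {k G V} [Field k] [Group G] [TopologicalSpace G] [AddCommGroup V] [Module k V], ∀ ρ t 𝓘,
ρ.IsAdmissible → (ρ.jacquetModule t).IsAdmissible`.
This file proves that statement **false** (`Representation.not_isAdmissible_jacquetModule`); the
intended characteristic-`0` statement is vendored and proved in the sibling file
`Literature.NumberTheory.Automorphic.JacquetLemma`
(`Representation.isAdmissible_jacquetModule_of_charZero`, `…_holds`).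

## The counterexample (namespace `Literature.NumberTheory.Automorphic.JacquetLemma.Counterexample`)

* `k = 𝔽₂`; `G = ∏_ℕ ℤ/2ℤ` (`Grp`, multiplicative notation, product of discrete topologies: a
  compact Hausdorff abelian topological group); `V = 𝔽₂ ⊕ 𝔽₂^{(ℕ)}` (`Vec`).
* `ρ(g)(a, b) = (a - ∑ⱼ bⱼ gⱼ, b)` (`unipRep`): a representation since `g ↦ (b ↦ ∑ⱼ bⱼ gⱼ)`
  is additive (`lc_mul`). It is smooth (`isSmooth_unipRep`: `Stab(a, b) ⊇ K_n` once
  `supp b < n`, where `K_n = {g | gⱼ = 0 ∀ j < n}`), and admissible (`isAdmissible_unipRep`: a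
  `K_n`-fixed `(a, b)` has `bⱼ = 0` for `j ≥ n`, testing against `δⱼ ∈ K_n`, so
  `V^{K_n} ⊆ 𝔽₂ ⊕ 𝔽₂ⁿ`, and every open subgroup contains some `K_n`). (It is the smooth dual
  of the cyclic `𝔽₂[[G]]`-module `𝔽₂ ⊕ ∏ⱼ 𝔽₂ tⱼ`, `tᵢ tⱼ = 0`, whose `G`-invariants are
  infinite-dimensional: in characteristic `p` admissibility is not inherited by coinvariants
  without a noetherianity input.)
* `t = (G, 1, G)` (`triple`) with the trivial Iwahori datum `N̄ = 1`, `a = 1`, `K_n` (`datum`):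
  the factorisation `K_n = 1 · 1 · K_n` and the contraction condition hold trivially.
* The Jacquet module is `V_G = V / 𝔽₂(1, 0) ≅ 𝔽₂^{(ℕ)}` with the action of the trivial group
  `M = 1`; the trivial group is a compact open subgroup of itself fixing everything, and `V_G`
  surjects onto `𝔽₂^{(ℕ)}` (the `G`-invariant second projection), which has the infinite basis
  `(δⱼ)`, so `V_G` is not finite-dimensional and the Jacquet module is not admissible
  (`not_isAdmissible_jacquetModule_unipRep`).

## References

* W. Casselman, *Introduction to the theory of admissible representations of `p`-adic reductive
  groups*, unpublished notes, draft 1 May 1995, Thm. 3.3.1 (the correct statement, for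
  admissible representations over `ℂ`).
-/

open scoped Pointwise

namespace Literature.NumberTheory.Automorphic.JacquetLemma

open _root_.Representation

namespace Counterexample

/-- The compact abelian group `G = ∏_{ℕ} ℤ/2ℤ`, written multiplicatively, with the product of the
discrete topologies (a compact, Hausdorff, totally disconnected topological group). [folklore] -/
abbrev Grp : Type := ℕ → Multiplicative (ZMod 2)

/-- The `𝔽₂`-vector space `V = 𝔽₂ ⊕ 𝔽₂^{(ℕ)}` carrying the counterexample. [folklore] -/
abbrev Vec : Type := ZMod 2 × (ℕ →₀ ZMod 2)

/-- The `j`-th coordinate of `g ∈ G` as an element of `𝔽₂`: `coord g j = gⱼ`. [folklore] -/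
def coord (g : Grp) (j : ℕ) : ZMod 2 := Multiplicative.toAdd (g j)

/-- The linear functional `b ↦ ∑ⱼ bⱼ gⱼ` on `𝔽₂^{(ℕ)}` attached to `g ∈ G`. [folklore] -/
noncomputable def lc (g : Grp) : (ℕ →₀ ZMod 2) →ₗ[ZMod 2] ZMod 2 :=
  Finsupp.linearCombination (ZMod 2) (coord g)

/-- `lc 1 = 0`. [folklore] -/
lemma lc_one : lc 1 = 0 := by
  refine LinearMap.ext fun b => ?_
  simp [lc, Finsupp.linearCombination_apply, coord]

/-- `lc (g h) = lc g + lc h`: `g ↦ lc g` is additive. [folklore] -/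
lemma lc_mul (g h : Grp) : lc (g * h) = lc g + lc h := by
  refine LinearMap.ext fun b => ?_
  simp only [lc, LinearMap.add_apply, Finsupp.linearCombination_apply, coord, Pi.mul_apply,
    toAdd_mul, smul_add, Finsupp.sum_add]

/-- If `gⱼ = 0` for all `j < n` and `b` is supported below `n`, then `∑ⱼ bⱼ gⱼ = 0`. [folklore] -/
lemma lc_apply_eq_zero {g : Grp} {n : ℕ} {b : ℕ →₀ ZMod 2} (hg : ∀ j < n, g j = 1)
    (hb : b.support ⊆ Finset.range n) : lc g b = 0 := by
  rw [lc, Finsupp.linearCombination_apply, Finsupp.sum]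
  refine Finset.sum_eq_zero fun j hj => ?_
  have hgj : g j = 1 := hg j (Finset.mem_range.1 (hb hj))
  simp [coord, hgj]

/-- `∑ᵢ bᵢ (δⱼ)ᵢ = bⱼ` for the `j`-th "basis vector" `δⱼ ∈ G`. [folklore] -/
lemma lc_mulSingle (j : ℕ) (b : ℕ →₀ ZMod 2) :
    lc (Pi.mulSingle j (Multiplicative.ofAdd 1)) b = b j := by
  classical
  rw [lc, Finsupp.linearCombination_apply, Finsupp.sum, Finset.sum_eq_single j]
  · simp [coord]
  · intro i _ hij
    simp [coord, Pi.mulSingle_eq_of_ne hij]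
  · intro hj
    simp [Finsupp.notMem_support_iff.1 hj]

/-- The endomorphism `(a, b) ↦ (a - ∑ⱼ bⱼ gⱼ, b)` of `V` attached to `g ∈ G`. [folklore] -/
noncomputable def unipEnd (g : Grp) : Vec →ₗ[ZMod 2] Vec where
  toFun v := (v.1 - lc g v.2, v.2)
  map_add' v w := by
    refine Prod.ext ?_ rfl
    simp only [Prod.fst_add, Prod.snd_add, map_add]
    abel
  map_smul' c v := by
    refine Prod.ext ?_ rfl
    simp only [Prod.smul_fst, Prod.smul_snd, map_smul, RingHom.id_apply, smul_eq_mul, mul_sub]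

/-- `unipEnd g (a, b) = (a - ∑ⱼ bⱼ gⱼ, b)`. [folklore] -/
@[simp] lemma unipEnd_apply (g : Grp) (v : Vec) : unipEnd g v = (v.1 - lc g v.2, v.2) := rfl

/-- The representation `ρ` of `G = ∏_ℕ ℤ/2ℤ` on `V = 𝔽₂ ⊕ 𝔽₂^{(ℕ)}`:
`ρ(g)(a, b) = (a - ∑ⱼ bⱼ gⱼ, b)` (a "unipotent" action: `G` fixes `𝔽₂ ⊕ 0` and acts on the
quotient trivially). It is the smooth dual of the cyclic `𝔽₂[[G]]`-module
`𝔽₂ ⊕ ∏ⱼ 𝔽₂ tⱼ` (`tᵢ tⱼ = 0`), whose `G`-invariants are infinite-dimensional. [folklore] -/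
noncomputable def unipRep : Representation (ZMod 2) Grp Vec where
  toFun := unipEnd
  map_one' := by
    refine LinearMap.ext fun v => Prod.ext ?_ rfl
    simp only [unipEnd_apply, lc_one, LinearMap.zero_apply, sub_zero, Module.End.one_apply]
  map_mul' g h := by
    refine LinearMap.ext fun v => Prod.ext ?_ rfl
    simp only [unipEnd_apply, lc_mul, LinearMap.add_apply, Module.End.mul_apply]
    abel

/-- `ρ(g)(a, b) = (a - ∑ⱼ bⱼ gⱼ, b)`, first component. [folklore] -/
@[simp] lemma unipRep_apply_fst (g : Grp) (v : Vec) : (unipRep g v).1 = v.1 - lc g v.2 := rfl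

/-- `ρ(g)(a, b) = (a - ∑ⱼ bⱼ gⱼ, b)`, second component. [folklore] -/
@[simp] lemma unipRep_apply_snd (g : Grp) (v : Vec) : (unipRep g v).2 = v.2 := rfl

/-- `ρ(g) v = v` iff `∑ⱼ bⱼ gⱼ = 0` (`v = (a, b)`). [folklore] -/
lemma unipRep_apply_eq_self_iff (g : Grp) (v : Vec) : unipRep g v = v ↔ lc g v.2 = 0 := by
  rw [Prod.ext_iff, unipRep_apply_fst, unipRep_apply_snd, sub_eq_self]
  exact and_iff_left rfl

/-- The compact open subgroups `K_n = {g | gⱼ = 0 for j < n}` of `G`. [folklore] -/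
def Kn (n : ℕ) : Subgroup Grp := Subgroup.pi (Set.Iio n) fun _ => ⊥

/-- Membership in `K_n`. [folklore] -/
lemma mem_Kn {n : ℕ} {g : Grp} : g ∈ Kn n ↔ ∀ j < n, g j = 1 := by
  simp [Kn, Subgroup.mem_pi, Subgroup.mem_bot]

/-- `K_n` as a set is the cylinder `∏_{j<n} {1} × ∏_{j ≥ n} ℤ/2ℤ`. [folklore] -/
lemma coe_Kn (n : ℕ) : (Kn n : Set Grp) = Set.pi (Set.Iio n) fun _ => {1} := by
  simp only [Kn, Subgroup.coe_pi, Subgroup.coe_bot]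

/-- `K_n` is open. [folklore] -/
lemma isOpen_Kn (n : ℕ) : IsOpen (Kn n : Set Grp) := by
  rw [coe_Kn]
  exact isOpen_set_pi (Set.finite_Iio n) fun _ _ => isOpen_discrete _

/-- `K_n` is compact. [folklore] -/
lemma isCompact_Kn (n : ℕ) : IsCompact (Kn n : Set Grp) := by
  rw [coe_Kn]
  exact (isClosed_set_pi fun _ _ => isClosed_discrete _).isCompact

/-- The `K_n` form a neighbourhood basis of `1` in the product topology. [folklore] -/
lemma exists_Kn_subset {U : Set Grp} (hU : U ∈ nhds (1 : Grp)) : ∃ n, (Kn n : Set Grp) ⊆ U := by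
  rw [nhds_pi, Filter.mem_pi] at hU
  obtain ⟨I, hI, t, ht, hsub⟩ := hU
  obtain ⟨n, hn⟩ := hI.bddAbove
  refine ⟨n + 1, fun g hg => hsub fun i hi => ?_⟩
  have hgi : g i = 1 := (mem_Kn.1 hg) i (Nat.lt_succ_of_le (hn hi))
  rw [hgi]
  exact mem_of_mem_nhds (ht i)

/-- The parabolic triple `(P, M, N) = (G, 1, G)`. [folklore] -/
def triple : ParabolicTriple Grp where
  P := ⊤
  M := ⊥
  N := ⊤
  M_le := bot_le
  N_le := le_rfl
  le_normalizer := Subgroup.le_normalizer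
  isComplement' := by
    rw [Subgroup.bot_subgroupOf, Subgroup.top_subgroupOf]
    exact Subgroup.isComplement'_bot_top

/-- The trivial Iwahori datum on `(G, 1, G)`: `N̄ = 1`, `a = 1`, `K_n` as above; the
factorisation `K_n = 1 · 1 · K_n` and the contraction condition hold trivially. [folklore] -/
def datum : triple.IwahoriDatum where
  Nbar := ⊥
  a := 1
  a_mem := Subgroup.one_mem _
  a_comm := fun m _ => by rw [mul_one, one_mul]
  K := Kn
  isOpen_K := isOpen_Kn
  isCompact_K := isCompact_Kn
  hasBasis_K := fun _ hU => exists_Kn_subset hU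
  factorization := fun n => by
    show (Kn n : Set Grp) = ((Kn n ⊓ ⊥ : Subgroup Grp) : Set Grp) *
      ((Kn n ⊓ ⊥ : Subgroup Grp) : Set Grp) * ((Kn n ⊓ ⊤ : Subgroup Grp) : Set Grp)
    rw [inf_bot_eq, inf_top_eq, Subgroup.coe_bot, Set.singleton_one, one_mul, one_mul]
  exists_conj_inf_Nbar_le := fun n j => ⟨0, by rw [inf_bot_eq, Subgroup.smul_bot]; exact bot_le⟩

/-- `ρ` is smooth: the stabiliser of `(a, b)` contains `K_n` as soon as `b` is supported below
`n`. [folklore] -/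
theorem isSmooth_unipRep : Representation.IsSmooth unipRep := by
  intro v
  obtain ⟨n, hn⟩ := Finset.exists_nat_subset_range v.2.support
  refine unipRep.isSmoothVector_of_le (isOpen_Kn n) fun g hg => ?_
  rw [mem_stabilizerSubgroup, unipRep_apply_eq_self_iff]
  exact lc_apply_eq_zero (mem_Kn.1 hg) hn

/-- `V^{K_n} ⊆ 𝔽₂ ⊕ 𝔽₂^{n}`: a `K_n`-fixed vector `(a, b)` has `bⱼ = 0` for `j ≥ n` (test
against `δⱼ ∈ K_n`); in particular `V^{K_n}` is finite-dimensional. [folklore] -/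
theorem finite_fixedPoints_Kn (n : ℕ) : Module.Finite (ZMod 2) ↥(unipRep.fixedPoints (Kn n)) := by
  haveI : Module.Finite (ZMod 2) ↥(Finsupp.supported (ZMod 2) (ZMod 2) (Set.Iio n : Set ℕ)) :=
    Module.Finite.equiv (Finsupp.supportedEquivFinsupp (Set.Iio n : Set ℕ)).symm
  let f : (ZMod 2 × ↥(Finsupp.supported (ZMod 2) (ZMod 2) (Set.Iio n : Set ℕ))) →ₗ[ZMod 2] Vec :=
    LinearMap.prodMap LinearMap.id (Submodule.subtype _)
  haveI : Module.Finite (ZMod 2) ↥(LinearMap.range f) :=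
    Module.Finite.of_surjective f.rangeRestrict f.surjective_rangeRestrict
  refine Submodule.finiteDimensional_of_le (S₂ := LinearMap.range f) fun v hv => ?_
  have hv' := (unipRep.mem_fixedPoints _ _).1 hv
  have hsupp : v.2 ∈ Finsupp.supported (ZMod 2) (ZMod 2) (Set.Iio n : Set ℕ) := by
    rw [Finsupp.mem_supported']
    intro j hj
    have hnj : n ≤ j := not_lt.1 fun h => hj (Set.mem_Iio.2 h)
    have hg : Pi.mulSingle j (Multiplicative.ofAdd (1 : ZMod 2)) ∈ Kn n := by
      rw [mem_Kn]
      intro i hi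
      exact Pi.mulSingle_eq_of_ne (ne_of_lt (lt_of_lt_of_le hi hnj)) _
    have h := (unipRep_apply_eq_self_iff _ _).1 (hv' _ hg)
    rwa [lc_mulSingle] at h
  exact ⟨(v.1, ⟨v.2, hsupp⟩), rfl⟩

/-- `ρ` is admissible: every open subgroup contains some `K_n`, and `V^{K_n}` is
finite-dimensional. [folklore] -/
theorem isAdmissible_unipRep : Representation.IsAdmissible unipRep := by
  refine ⟨isSmooth_unipRep, fun K _ => ?_⟩
  obtain ⟨n, hn⟩ := exists_Kn_subset (K.isOpen.mem_nhds K.one_mem)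
  haveI := finite_fixedPoints_Kn n
  exact Submodule.finiteDimensional_of_le (unipRep.fixedPoints_antitone fun g hg => hn hg)

/-- The Jacquet module of `ρ` with respect to `(G, 1, G)` — the coinvariants `V_G ≅ 𝔽₂^{(ℕ)}` as
a representation of the trivial group — is **not** admissible: the trivial group is a compact
open subgroup of itself fixing everything, and `V_G` surjects onto the infinite-dimensional
space `𝔽₂^{(ℕ)}` (second projection, which is `G`-invariant). [folklore] -/
theorem not_isAdmissible_jacquetModule_unipRep :
    ¬ (unipRep.jacquetModule triple).IsAdmissible := by
  intro h
  have hc : IsCompact ((⊤ : OpenSubgroup triple.M) : Set triple.M) := by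
    refine Set.Subsingleton.isCompact fun x _ y _ => ?_
    exact Subtype.ext ((Subgroup.mem_bot.1 x.2).trans (Subgroup.mem_bot.1 y.2).symm)
  have hfin := h.2 ⊤ hc
  have htop : (unipRep.jacquetModule triple).fixedPoints
      ((⊤ : OpenSubgroup triple.M) : Subgroup triple.M) = ⊤ := by
    refine eq_top_iff.2 fun x _ => ?_
    rw [mem_fixedPoints]
    intro m _
    have hm : m = 1 := Subtype.ext (Subgroup.mem_bot.1 m.2)
    rw [hm, map_one, Module.End.one_apply]
  rw [htop] at hfin
  haveI : Module.Finite (ZMod 2) (triple.restrict unipRep).Coinvariants :=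
    @Module.Finite.equiv _ _ _ _ _ _ _ _ hfin Submodule.topEquiv
  have hinv : ∀ g : ↥(triple.N.subgroupOf triple.P),
      LinearMap.snd (ZMod 2) (ZMod 2) (ℕ →₀ ZMod 2) ∘ₗ (triple.restrict unipRep) g =
        LinearMap.snd (ZMod 2) (ZMod 2) (ℕ →₀ ZMod 2) :=
    fun g => LinearMap.ext fun v => rfl
  have hsurj : Function.Surjective
      (Coinvariants.lift (triple.restrict unipRep) (LinearMap.snd (ZMod 2) (ZMod 2) (ℕ →₀ ZMod 2))
        hinv) :=
    fun b => ⟨Coinvariants.mk _ ((0 : ZMod 2), b), rfl⟩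
  exact Module.not_finite_of_infinite_basis
    (Finsupp.basisSingleOne : Module.Basis ℕ (ZMod 2) (ℕ →₀ ZMod 2))
    (Module.Finite.of_surjective _ hsurj)

/-- The mis-stated fact fails for `(k, G, V) = (𝔽₂, ∏_ℕ ℤ/2ℤ, 𝔽₂ ⊕ 𝔽₂^{(ℕ)})`. [folklore] -/
theorem not_isAdmissible_jacquetModule_instance :
    ¬ Representation.isAdmissible_jacquetModule (k := ZMod 2) (G := Grp) (V := Vec) :=
  fun h => not_isAdmissible_jacquetModule_unipRep (h unipRep triple datum isAdmissible_unipRep)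

end Counterexample

end Literature.NumberTheory.Automorphic.JacquetLemma

namespace Representation

open Literature.NumberTheory.Automorphic

/-- **The mis-stated fact `Representation.isAdmissible_jacquetModule` is false**: its universal
closure (over `k, G, V` in `Type`) fails at `(𝔽₂, ∏_ℕ ℤ/2ℤ, 𝔽₂ ⊕ 𝔽₂^{(ℕ)})` with the
representation `ρ(g)(a, b) = (a - ∑ⱼ bⱼ gⱼ, b)`, the triple `(G, 1, G)` and the trivial Iwahori
datum (`Literature.NumberTheory.Automorphic.JacquetLemma.Counterexample`): `ρ` is admissible but
`V_G ≅ 𝔽₂^{(ℕ)}` is infinite-dimensional. The intended characteristic-`0` statement is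
`isAdmissible_jacquetModule_of_charZero` (proved). [folklore] -/
theorem not_isAdmissible_jacquetModule :
    ¬ ∀ {k G V : Type} [Field k] [Group G] [TopologicalSpace G] [AddCommGroup V] [Module k V],
      isAdmissible_jacquetModule (k := k) (G := G) (V := V) :=
  fun h => JacquetLemma.Counterexample.not_isAdmissible_jacquetModule_instance h

end Representation
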